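import Literature.Computability.Complexity.ComplementTranslation
import HarnessLib

/-!
# `NE = coNE` iff every tally `NP` language is in `coNP` (Book's tally translation for complements)

Literature / complexity toolkit (problem `PneNP`; companion of `book1974_thm1_holds`, the tree's
`NE ⊆ E ↔` "every tally `NP` language is in `P`", and of `ComplementTranslation.lean`,
`NP = coNP ⟹ NE = coNE ⟹ NEXP = coNEXP`). The same two lemmas of Book 1974 — Lemma 2
(`L ∈ NTIME(2^{an}) ⟹ tallyDecodeFn ⁻¹' L ∈ NP`, `AvgTallyNE.tallyTruncLang_mem_NP`) and Lemma 3
(`g ∈ FE`, `L ∈ NP ⟹ g ⁻¹' L ∈ NE`, `Book1974.preimage_NP_mem_NE`) — run with `coNP` in place of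
`P` give the complementation analogue of Book's Theorem 1:

* `tally_NP_mem_coNP_of_co_NE_eq_NE` — if `NE = coNE` then every tally (`⊆ 0*`) `NP` language `T`
  is in `coNP`: `L = pad0Fn ⁻¹' T ∈ NE`, so `Lᶜ ∈ NE`, so `G = tallyDecodeFn ⁻¹' Lᶜ ∈ NP`, and on a
  nonempty word `w`, `w ∈ G ↔ 0^{|w|} ∉ T`; hence `Tᶜ = (0*)ᶜ ∪ (G ∖ {ε})` up to the empty word;
* `co_NE_eq_NE_of_tally_NP_subset_coNP` — conversely, for `L ∈ NTIME(2^{an})` the tally language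
  `T₀ = 0* ⊓ tallyDecodeFn ⁻¹' L ∈ NP` is in `coNP` by hypothesis, and `Lᶜ = pad0Fn ⁻¹' T₀ᶜ ∈ NE`;
* `co_NE_eq_NE_iff_tally_NP_subset_coNP` — the equivalence.

Thus "some tally set lies in `NP ∖ coNP`" is EQUIVALENT to `NE ≠ coNE`, a hypothesis above
`NP ≠ coNP` (cf. Hartmanis–Immerman–Sewelson 1985, Cor. 17 and p. 180 for the oracle subtleties of
the sparse/coNP analogue). All proved; no named fact, no definition.

## References

* R. V. Book, *Tally languages and complexity classes*, Information and Control 26 (1974)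
  186–193, Lemma 2 (p. 187), Lemma 3 (p. 188), Theorem 1 (p. 189) [Book1974].
* J. Hartmanis, N. Immerman, V. Sewelson, *Sparse sets in NP−P: EXPTIME versus NEXPTIME*,
  Information and Control 65 (1985), Cor. 17 (p. 179) and p. 180 [HartmanisImmermanSewelson1985].
* J. Krajíček, *Proof complexity*, CUP 2019, §21.1 (the classes `NE`, `coNE`) [KrajicekProofComplexity2019].
-/

noncomputable section

namespace Literature.Computability.Complexity

open _root_.Computability Nondeterministic Book1974 Brick
open Literature.Barriers.PneNP (IsTally)
open Literature.Computability.MetaComplexity.AvgTallyNE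
open NKannan (mem_inf_iff' mem_sup_iff' mem_compl_iff')

namespace TallyComplement

/-! ### Membership bookkeeping (definitional)

Membership in `A ⊓ B`, `A ⊔ B`, `Aᶜ` is `NKannan.mem_inf_iff'` / `mem_sup_iff'` / `mem_compl_iff'`
(`NondeterministicKannanQuantifiers.lean`, opened below); only the two unfoldings specific to this
file are kept here. -/

/-- Membership in `{ε}` (`Book1974.nilLang`). [folklore] -/
private theorem mem_nilLang {x : List Bool} : x ∈ nilLang ↔ x = [] := Iff.rfl

/-- A class membership `L ∈ co C` unfolds to `Lᶜ ∈ C`. [folklore] -/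
private theorem mem_co_iff {C : Set (Language Bool)} {L : Language Bool} : L ∈ co C ↔ Lᶜ ∈ C := Iff.rfl

/-! ### Closure of `NP` under union (from the brick closure algebra) -/

/-- `NP` is closed under binary union with a `P` language on the left: the verifier accepts
`⟨x, y⟩` if `x ∈ A` or `y` witnesses `x ∈ B`. [cite: AroraBarakCC2009, §2.1 (closure properties of NP)] -/
private theorem sup_P_mem_NP {A B : Language Bool} (hA : A ∈ Classes.P) (hB : B ∈ NP) : A ⊔ B ∈ NP := by
  obtain ⟨B', hB', p, hp⟩ := hB
  have hA' : pre fstF A ∈ Classes.P := by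
    rw [pre_eq_preimage]; exact preimage_mem_P hA fstF_mem_FP
  refine ⟨pre fstF A ⊔ B', union_mem_P hA' hB', p, fun x => ?_⟩
  constructor
  · rintro (hx | hx)
    · refine ⟨[], Nat.zero_le _, Or.inl ?_⟩
      show fstF (boolPair x []) ∈ A
      rw [fstF_boolPair]; exact hx
    · obtain ⟨y, hy, hxy⟩ := (hp x).1 hx
      exact ⟨y, hy, Or.inr hxy⟩
  · rintro ⟨y, hy, hxy | hxy⟩
    · have hxA : fstF (boolPair x y) ∈ A := hxy
      rw [fstF_boolPair] at hxA; exact Or.inl hxA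
    · exact Or.inr ((hp x).2 ⟨y, hy, hxy⟩)

/-- `NP` is closed under binary union with a `P` language on the right. [cite: AroraBarakCC2009, §2.1 (closure properties of NP)] -/
private theorem sup_P_mem_NP' {A B : Language Bool} (hA : A ∈ NP) (hB : B ∈ Classes.P) : A ⊔ B ∈ NP := by
  rw [sup_comm]; exact sup_P_mem_NP hB hA

end TallyComplement

open TallyComplement

/-! ### `NE = coNE` ⟹ tally `NP` languages are in `coNP` -/

/-- **If `NE = coNE` then every tally `NP` language is in `coNP`** (Book's tally translation for
complements). With `L = pad0Fn ⁻¹' T ∈ NE` (Lemma 3), `Lᶜ ∈ NE` by the hypothesis and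
`G = tallyDecodeFn ⁻¹' Lᶜ ∈ NP` (Lemma 2); for a nonempty word `w`, `w ∈ G ↔ 0^{|w|} ∉ T`, and a
tally `T` contains only zero words, so `Tᶜ` is `(0*)ᶜ ∪ (G ⊓ {ε}ᶜ)`, joined with `{ε}` when
`ε ∉ T` — an `NP` language. [cite: Book1974, Lemma 2 (p. 187) and Lemma 3 (p. 188)]
[cite: KrajicekProofComplexity2019, §21.1] -/
theorem tally_NP_mem_coNP_of_co_NE_eq_NE (hNE : co NE = NE) {T : Language Bool} (hT : IsTally T)
    (hTNP : T ∈ NP) : T ∈ coNP := by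
  -- the NE detour
  have hL : pre pad0Fn T ∈ NE := preimage_NP_mem_NE pad0Fn_mem_FE hTNP
  have hLc : (pre pad0Fn T)ᶜ ∈ NE := by
    have : (pre pad0Fn T)ᶜ ∈ co NE := by
      rw [mem_co_iff, compl_compl]; exact hL
    rwa [hNE] at this
  simp only [NE, Set.mem_iUnion] at hLc
  obtain ⟨a, ha⟩ := hLc
  have hG : pre tallyDecodeFn (pre pad0Fn T)ᶜ ∈ NP := tallyTruncLang_mem_NP ha
  -- the key equivalence on nonempty words
  have key : ∀ w : List Bool, w ≠ [] → (w ∉ T ↔ w ∉ zerosFmt ∨ w ∈ pre tallyDecodeFn (pre pad0Fn T)ᶜ) := by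
    intro w hw
    rw [mem_pre_iff, mem_compl_iff', mem_pre_iff, pad0Fn_tallyDecodeFn hw]
    constructor
    · intro hwT
      by_cases hz : w ∈ zerosFmt
      · right
        have hrep : w = List.replicate w.length false :=
          List.eq_replicate_iff.2 ⟨rfl, (mem_zerosFmt_iff w).1 hz⟩
        rwa [← hrep]
      · exact Or.inl hz
    · rintro (hz | hG') hwT
      · exact hz (eq_replicate_of_isTally hT hwT ▸ replicate_false_mem_zerosFmt w.length)
      · exact hG' (eq_replicate_of_isTally hT hwT ▸ hwT)
  -- `Tᶜ` as an NP language
  have hcore : zerosFmtᶜ ⊔ (nilLangᶜ ⊓ pre tallyDecodeFn (pre pad0Fn T)ᶜ) ∈ NP :=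
    sup_P_mem_NP (compl_mem_P_iff.2 zerosFmt_mem_P)
      (inter_P_mem_polyExists (fun _ _ h₁ h₂ => inter_mem_P h₁ h₂)
        (compl_mem_P_iff.2 nilLang_mem_P) hG)
  show Tᶜ ∈ NP
  by_cases h0 : ([] : List Bool) ∈ T
  · have hEq : Tᶜ = zerosFmtᶜ ⊔ (nilLangᶜ ⊓ pre tallyDecodeFn (pre pad0Fn T)ᶜ) := by
      ext w
      rw [mem_compl_iff', mem_sup_iff', mem_compl_iff', mem_inf_iff', mem_compl_iff', mem_nilLang]
      rcases eq_or_ne w [] with rfl | hw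
      · refine ⟨fun h => absurd h0 h, ?_⟩
        rintro (hz | ⟨hne, -⟩)
        · exact absurd (replicate_false_mem_zerosFmt 0) hz
        · exact absurd rfl hne
      · rw [key w hw]
        exact ⟨fun h => h.imp id fun hG' => ⟨hw, hG'⟩, fun h => h.imp id fun hG' => hG'.2⟩
    rw [hEq]
    exact hcore
  · have hEq : Tᶜ = (zerosFmtᶜ ⊔ (nilLangᶜ ⊓ pre tallyDecodeFn (pre pad0Fn T)ᶜ)) ⊔ nilLang := by
      ext w
      rw [mem_compl_iff', mem_sup_iff', mem_sup_iff', mem_compl_iff', mem_inf_iff', mem_compl_iff',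
        mem_nilLang]
      rcases eq_or_ne w [] with rfl | hw
      · exact ⟨fun _ => Or.inr rfl, fun _ => h0⟩
      · rw [key w hw]
        constructor
        · exact fun h => Or.inl (h.imp id fun hG' => ⟨hw, hG'⟩)
        · rintro ((hz | ⟨-, hG'⟩) | hnil)
          · exact Or.inl hz
          · exact Or.inr hG'
          · exact absurd hnil hw
    rw [hEq]
    exact sup_P_mem_NP' hcore nilLang_mem_P

/-! ### Tally `NP` languages in `coNP` ⟹ `NE = coNE` -/

/-- **If every tally `NP` language is in `coNP` then `NE = coNE`.** For `L ∈ NTIME(2^{an})` the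
tally language `T₀ = 0* ⊓ tallyDecodeFn ⁻¹' L ∈ NP` (Lemma 2) is in `coNP` by hypothesis, and
`x ∉ L ↔ pad0Fn x ∉ T₀` (the pad is a zero word decoding to `x`), so `Lᶜ = pad0Fn ⁻¹' T₀ᶜ ∈ NE`
(Lemma 3). [cite: Book1974, Lemma 2 (p. 187) and Lemma 3 (p. 188)] [cite: KrajicekProofComplexity2019, §21.1] -/
theorem co_NE_eq_NE_of_tally_NP_subset_coNP
    (h : ∀ T : Language Bool, IsTally T → T ∈ NP → T ∈ coNP) : co NE = NE := by
  -- it suffices that `NE` is closed under complement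
  suffices hc : ∀ L : Language Bool, L ∈ NE → Lᶜ ∈ NE by
    refine co_eq_self_of_compl_mem_iff fun L => ⟨fun hL => ?_, hc L⟩
    simpa only [compl_compl] using hc _ hL
  intro L hL
  simp only [NE, Set.mem_iUnion] at hL
  obtain ⟨a, ha⟩ := hL
  have hNP : pre tallyDecodeFn L ∈ NP := tallyTruncLang_mem_NP ha
  have hT₀ : zerosFmt ⊓ pre tallyDecodeFn L ∈ NP :=
    inter_P_mem_polyExists (fun _ _ h₁ h₂ => inter_mem_P h₁ h₂) zerosFmt_mem_P hNP
  have htally : IsTally (zerosFmt ⊓ pre tallyDecodeFn L) := fun w hw => (mem_zerosFmt_iff w).1 hw.1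
  have hco : (zerosFmt ⊓ pre tallyDecodeFn L)ᶜ ∈ NP := h _ htally hT₀
  have hEq : Lᶜ = pre pad0Fn (zerosFmt ⊓ pre tallyDecodeFn L)ᶜ := by
    ext x
    rw [mem_compl_iff', mem_pre_iff, mem_compl_iff', mem_inf_iff', mem_pre_iff, tallyDecodeFn_pad0Fn]
    exact ⟨fun hx h => hx h.2, fun h hx => h ⟨pad0Fn_apply x ▸ replicate_false_mem_zerosFmt _, hx⟩⟩
  rw [hEq]
  exact preimage_NP_mem_NE pad0Fn_mem_FE hco

/-- **Book's Theorem 1 for complements: `NE = coNE` iff every tally `NP` language is in `coNP`**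
(equivalently: `NE ≠ coNE` iff some tally set lies in `NP ∖ coNP`).
[cite: Book1974, Theorem 1 (p. 189), Lemmas 2–3] [cite: HartmanisImmermanSewelson1985, Cor. 17 (p. 179)] -/
theorem co_NE_eq_NE_iff_tally_NP_subset_coNP :
    co NE = NE ↔ ∀ T : Language Bool, IsTally T → T ∈ NP → T ∈ coNP :=
  ⟨fun hNE _ hT hTNP => tally_NP_mem_coNP_of_co_NE_eq_NE hNE hT hTNP,
    co_NE_eq_NE_of_tally_NP_subset_coNP⟩

/-- **`NE ≠ coNE` iff some tally language is in `NP` but not in `coNP`.**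
[cite: Book1974, Theorem 1 (p. 189), Lemmas 2–3] [cite: HartmanisImmermanSewelson1985, Cor. 17 (p. 179)] -/
theorem co_NE_ne_NE_iff_exists_tally_NP_not_coNP :
    co NE ≠ NE ↔ ∃ T : Language Bool, IsTally T ∧ T ∈ NP ∧ T ∉ coNP := by
  rw [Ne, co_NE_eq_NE_iff_tally_NP_subset_coNP]
  push Not
  exact Iff.rfl

end Literature.Computability.Complexity

end
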